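import Mathlib
import Summits.ValiantsHypothesis.ValiantsHypothesis.Theorems.GrenetZeonTwoDimCoefficientsDualUnipotentTraceConstraints
import Summits.ValiantsHypothesis.ValiantsHypothesis.Theorems.GrenetZeonTwoDimCoefficientsDualUnipotentTraceProduct

/-!
# Crux `GrenetZeon.TwoDimCoefficients` (stmt-ValiantsHypothesis-8062), stub `stub_dualUnipotent`:
# the unipotent dual model IS the constrained nilpotent pencil (an `↔`, same width)

The tree has the forward normal form (`exists_constrained_pencil_of_dualUnipotentRepr`,
`…DualUnipotentTraceConstraints.lean`): a unipotent dual representation of `per_n` of size `m`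
yields LINEAR `m × m` pencils `N`, `M` with `N^m = 0`, `per_n = tr(N^{n−1}·M)` and
`tr(N^j·M) = 0` for `j ≠ n − 1`.  This file proves the CONVERSE at the same width and packages
the equivalence, so that the open stub `DualUnipotentBound` becomes, verbatim, a statement about
constrained nilpotent pencils and nothing else:

* `trace_adjugate_one_sub_mul` — for any polynomial matrix `N` with `N^m = 0`:
  `tr(adj(1 − N)·M) = det(1 − N) · Σ_{j<m} tr(N^j·M)` (`(1 − N)⁻¹ = Σ_{j<m} N^j`,
  `adj = det • inverse`), and `det(1 − N)` is a non-zero constant (`exists_det_one_sub_eq_C`: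
  a unit of `ℂ[x]`).
* `dualUnipotentRepr_of_constrainedPencil` — affine `N`, `M` with `N^m = 0`,
  `per_n = tr(N^{n−1}·M)` and `tr(N^j·M) = 0` (`j < m`, `j ≠ n − 1`) give `DualUnipotentRepr n m`
  (`A = 1 − N`, `B = M`, `α = 0`, `β = det(1 − N)⁻¹`).
* `dualUnipotentRepr_iff_constrainedPencil` (`n ≥ 1`) and
  `dualUnipotentBound_iff_constrainedPencil` — the stub is EQUIVALENT to: constrained nilpotent
  linear pencils carrying `per_n` have width `m ≥ n²/C`.
* `dualUnipotentRepr_mul_of_pencil` — WITHOUT the constraints a pair (`N` nilpotent linear,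
  `per_n = tr(N^{n−1}·M)`) still gives `DualUnipotentRepr n (n·m)` (layering, via
  `dualUnipotentRepr_of_trace_prod`); so the constraints are worth at most the factor `n` in width,
  and `DualUnipotentBound` implies the LINEAR bound `n ≤ C·m` for unconstrained pairs
  (`le_mul_of_pencil_of_dualUnipotentBound`).
* §4 `dualUnipotentRepr_iff_resolvent` / `dualUnipotentBound_iff_resolvent` — the RESOLVENT form:
  for LINEAR `N`, `M` the constraints are automatic (homogeneous components,
  `trace_pow_mul_eq_of_sum_eq`), so `DualUnipotentRepr n m ↔ ∃ N, M` linear, `N^m = 0`,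
  `per_n = tr((1 − N)⁻¹·M)`; the stub reads "`per_n = tr((1 − N)⁻¹·M)` forces `m ≥ n²/C`".

HONEST FRAMING: a same-width equivalence (bookkeeping that removes `det`, `adj` and the scalars
from the problem statement); the stub stays open-problem grade; the crux (an ASIDE item) and
`VP ≠ VNP` are not moved by anything here.

References: L. G. Valiant, STOC 1979, §2 (trace/ABP gadgets); T. Mignon, N. Ressayre,
Int. Math. Res. Not. 2004:79.
-/

-- single-conjunct layout `Summits/ValiantsHypothesis/ValiantsHypothesis`: the duplicated namespace
-- component is mandated by the tree.
set_option linter.dupNamespace false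

noncomputable section

namespace Summit.ValiantsHypothesis.ValiantsHypothesis.Cruxes.TwoDimCoefficients.DimTwoCases

open Literature.Computability.AlgebraicComplexity Matrix MvPolynomial

variable {n m : ℕ}

/-! ### `1 − N` for a nilpotent polynomial matrix `N` -/

section OneSub

/-- `1 − N` is affine when `N` is. [folklore] -/
theorem isAffine_one_sub (N : AffMat n m) (hN : IsAffine N) : IsAffine (1 - N) := by
  intro i j
  rw [Matrix.sub_apply]
  refine (totalDegree_sub _ _).trans (max_le ?_ (hN i j))
  by_cases hij : i = j
  · subst hij
    rw [Matrix.one_apply_eq, totalDegree_one]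
    exact Nat.zero_le _
  · rw [Matrix.one_apply_ne hij, totalDegree_zero]
    exact Nat.zero_le _

/-- If `N^m = 0` then `(1 − N) · Σ_{j<m} N^j = 1`. [folklore] -/
theorem one_sub_mul_sum_pow (N : AffMat n m) (hnil : N ^ m = 0) :
    (1 - N) * ∑ j ∈ Finset.range m, N ^ j = 1 := by
  rw [mul_neg_geom_sum, hnil, sub_zero]

/-- If `N^m = 0` then `det(1 − N)` is a unit of `ℂ[x]`. [folklore] -/
theorem isUnit_det_one_sub (N : AffMat n m) (hnil : N ^ m = 0) : IsUnit (1 - N).det :=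
  Matrix.isUnit_det_of_right_inverse (one_sub_mul_sum_pow N hnil)

/-- If `N^m = 0` then `det(1 − N)` is a NON-ZERO CONSTANT (the units of `ℂ[x]` are the non-zero
scalars). [folklore] -/
theorem exists_det_one_sub_eq_C (N : AffMat n m) (hnil : N ^ m = 0) :
    ∃ c : ℂ, c ≠ 0 ∧ (1 - N).det = C c := by
  obtain ⟨c, hc, h⟩ := (MvPolynomial.isUnit_iff_eq_C_of_isReduced).1 (isUnit_det_one_sub N hnil)
  exact ⟨c, hc.ne_zero, h⟩

/-- If `N^m = 0` then `(1 − N)⁻¹ = Σ_{j<m} N^j`. [folklore] -/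
theorem inv_one_sub_eq_sum_pow (N : AffMat n m) (hnil : N ^ m = 0) :
    (1 - N)⁻¹ = ∑ j ∈ Finset.range m, N ^ j :=
  Matrix.inv_eq_right_inv (one_sub_mul_sum_pow N hnil)

/-- If `N^m = 0` then `adj(1 − N) = det(1 − N) • Σ_{j<m} N^j`. [folklore] -/
theorem adjugate_one_sub_eq (N : AffMat n m) (hnil : N ^ m = 0) :
    (1 - N).adjugate = (1 - N).det • ∑ j ∈ Finset.range m, N ^ j := by
  rw [adjugate_eq_det_smul_inv _ (isUnit_det_one_sub N hnil), inv_one_sub_eq_sum_pow N hnil]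

/-- **The resolvent trace.** If `N^m = 0` then, for every `M`,
`tr(adj(1 − N)·M) = det(1 − N) · Σ_{j<m} tr(N^j·M)`. [folklore] -/
theorem trace_adjugate_one_sub_mul (N M : AffMat n m) (hnil : N ^ m = 0) :
    ((1 - N).adjugate * M).trace = (1 - N).det * ∑ j ∈ Finset.range m, (N ^ j * M).trace := by
  rw [adjugate_one_sub_eq N hnil, Matrix.smul_mul, Matrix.trace_smul, Finset.sum_mul,
    Matrix.trace_sum, smul_eq_mul]

end OneSub

/-! ### Constrained pencil ⟹ unipotent dual representation (same width) -/

section Converse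

/-- Under the trace constraints the resolvent sum collapses to the single term `tr(N^{n−1}·M)`
(also when `n − 1 ≥ m`, where both sides vanish). [folklore] -/
theorem sum_trace_pow_mul_eq (N M : AffMat n m) (hnil : N ^ m = 0)
    (hcon : ∀ j < m, j ≠ n - 1 → (N ^ j * M).trace = 0) :
    ∑ j ∈ Finset.range m, (N ^ j * M).trace = (N ^ (n - 1) * M).trace := by
  by_cases hlt : n - 1 < m
  · rw [Finset.sum_eq_single_of_mem (n - 1) (Finset.mem_range.2 hlt)]
    intro j hj hjn
    exact hcon j (Finset.mem_range.1 hj) hjn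
  · have hzero : N ^ (n - 1) = 0 := by
      obtain ⟨k, hk⟩ : ∃ k, n - 1 = m + k := ⟨n - 1 - m, by omega⟩
      rw [hk, pow_add, hnil, zero_mul]
    rw [hzero, zero_mul, Matrix.trace_zero]
    refine Finset.sum_eq_zero fun j hj => hcon j (Finset.mem_range.1 hj) ?_
    have := Finset.mem_range.1 hj
    omega

/-- **Constrained pencil ⟹ `DualUnipotentRepr` at the same width.**  If `N`, `M` are affine
`m × m` matrices over `ℂ[x_{ij}]` with `N^m = 0`, `per_n = tr(N^{n−1}·M)` and `tr(N^j·M) = 0` for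
all `j < m`, `j ≠ n − 1`, then `DualUnipotentRepr n m`: take `A = 1 − N` (`det A` a non-zero
constant `c`, `adj A = c·Σ_j N^j`), `B = M`, `α = 0`, `β = c⁻¹`. [folklore] -/
theorem dualUnipotentRepr_of_constrainedPencil (N M : AffMat n m) (hN : IsAffine N)
    (hM : IsAffine M) (hnil : N ^ m = 0) (hper : perPoly (Fin n) ℂ = (N ^ (n - 1) * M).trace)
    (hcon : ∀ j < m, j ≠ n - 1 → (N ^ j * M).trace = 0) : DualUnipotentRepr n m := by
  obtain ⟨c, hc, hdet⟩ := exists_det_one_sub_eq_C N hnil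
  refine ⟨0, c⁻¹, c, 1 - N, M, isAffine_one_sub N hN, hM, hc, hdet, ?_⟩
  rw [trace_adjugate_one_sub_mul N M hnil, sum_trace_pow_mul_eq N M hnil hcon, ← hper, hdet,
    map_zero, zero_mul, zero_add, ← mul_assoc, ← map_mul, inv_mul_cancel₀ hc, map_one, one_mul]

/-- **The unipotent dual model IS the constrained nilpotent linear pencil** (`n ≥ 1`):
`DualUnipotentRepr n m` holds iff there are `m × m` matrices `N`, `M` of LINEAR FORMS with
`N^m = 0`, `per_n = tr(N^{n−1}·M)` and `tr(N^j·M) = 0` for every `j ≠ n − 1`.  (Forward: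
`exists_constrained_pencil_of_dualUnipotentRepr`; backward: `dualUnipotentRepr_of_constrainedPencil`.)
[folklore] -/
theorem dualUnipotentRepr_iff_constrainedPencil (hn : 1 ≤ n) :
    DualUnipotentRepr n m ↔
      ∃ N M : AffMat n m, (∀ i j, (N i j).IsHomogeneous 1) ∧ (∀ i j, (M i j).IsHomogeneous 1) ∧
        N ^ m = 0 ∧ perPoly (Fin n) ℂ = (N ^ (n - 1) * M).trace ∧
        ∀ j : ℕ, j ≠ n - 1 → (N ^ j * M).trace = 0 := by
  refine ⟨exists_constrained_pencil_of_dualUnipotentRepr hn, ?_⟩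
  rintro ⟨N, M, hN, hM, hnil, hper, hcon⟩
  exact dualUnipotentRepr_of_constrainedPencil N M (fun i j => (hN i j).totalDegree_le)
    (fun i j => (hM i j).totalDegree_le) hnil hper (fun j _ hj => hcon j hj)

/-- **The stub in pencil currency.**  `DualUnipotentBound` is EQUIVALENT to: there are `C`, `n₀`
such that for `n ≥ n₀`, every constrained nilpotent linear pencil carrying `per_n`
(`N`, `M` linear `m × m`, `N^m = 0`, `per_n = tr(N^{n−1}·M)`, `tr(N^j·M) = 0` for `j ≠ n − 1`)
has `n² ≤ C·m`. [folklore] -/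
theorem dualUnipotentBound_iff_constrainedPencil :
    DualUnipotentBound ↔
      ∃ C n₀ : ℕ, ∀ n ≥ n₀, ∀ m : ℕ,
        (∃ N M : AffMat n m, (∀ i j, (N i j).IsHomogeneous 1) ∧ (∀ i j, (M i j).IsHomogeneous 1) ∧
          N ^ m = 0 ∧ perPoly (Fin n) ℂ = (N ^ (n - 1) * M).trace ∧
          ∀ j : ℕ, j ≠ n - 1 → (N ^ j * M).trace = 0) → n ^ 2 ≤ C * m := by
  constructor
  · rintro ⟨C, n₀, h⟩
    refine ⟨C, max n₀ 1, fun n hn m hP => h n (le_of_max_le_left hn) m ?_⟩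
    exact (dualUnipotentRepr_iff_constrainedPencil (le_of_max_le_right hn)).2 hP
  · rintro ⟨C, n₀, h⟩
    refine ⟨C, max n₀ 1, fun n hn m hrep => h n (le_of_max_le_left hn) m ?_⟩
    exact (dualUnipotentRepr_iff_constrainedPencil (le_of_max_le_right hn)).1 hrep

end Converse

/-! ### Without the constraints: the layering price is the factor `n` -/

section Unconstrained

/-- **Unconstrained pairs, layered.**  If `N`, `M` are affine `m × m` matrices with
`per_n = tr(N^{n−1}·M)` (`n ≥ 1`; NO trace constraints, `N` need not even be nilpotent), then
`DualUnipotentRepr n (n·m)`: `per_n = tr(X₁ ⋯ X_n)` with `X₁ = ⋯ = X_{n−1} = N`, `X_n = M`, and a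
trace product of width `m` embeds at size `n·m` (`dualUnipotentRepr_of_trace_prod`). [folklore] -/
theorem dualUnipotentRepr_mul_of_pencil (hn : 1 ≤ n) (N M : AffMat n m) (hN : IsAffine N)
    (hM : IsAffine M) (hper : perPoly (Fin n) ℂ = (N ^ (n - 1) * M).trace) :
    DualUnipotentRepr n (n * m) := by
  obtain ⟨k, rfl⟩ : ∃ k, n = k + 1 := ⟨n - 1, by omega⟩
  simp only [Nat.add_sub_cancel] at hper
  refine dualUnipotentRepr_of_trace_prod (Nat.succ_le_succ (Nat.zero_le k))
    (Fin.snoc (fun _ : Fin k => N) M) ?_ ?_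
  · intro i
    rcases Fin.eq_castSucc_or_eq_last i with ⟨j, rfl⟩ | rfl
    · rw [Fin.snoc_castSucc]; exact hN
    · rw [Fin.snoc_last]; exact hM
  · rw [hper, List.ofFn_succ', List.concat_eq_append, List.prod_append, List.prod_singleton]
    simp only [Fin.snoc_castSucc, Fin.snoc_last, List.ofFn_const, List.prod_replicate]

/-- **What the stub says about unconstrained pairs: a LINEAR width bound.**  Under
`DualUnipotentBound` (constant `C`), every pair of affine `m × m` matrices with
`per_n = tr(N^{n−1}·M)` and `m ≥ 1`, `n` large, has `n ≤ C·m` (from `n² ≤ C·(n·m)`).  So the trace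
constraints `tr(N^j·M) = 0` (`j ≠ n − 1`) are worth at most the factor `n` between the linear and
the quadratic regime. [folklore] -/
theorem le_mul_of_pencil_of_dualUnipotentBound (hD : DualUnipotentBound) :
    ∃ C n₀ : ℕ, ∀ n ≥ n₀, ∀ (m : ℕ) (N M : AffMat n m), IsAffine N → IsAffine M →
      perPoly (Fin n) ℂ = (N ^ (n - 1) * M).trace → n ≤ C * m := by
  obtain ⟨C, n₀, h⟩ := hD
  refine ⟨C, max n₀ 1, fun n hn m N M hN hM hper => ?_⟩
  have hn1 : 1 ≤ n := le_of_max_le_right hn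
  have hsq : n ^ 2 ≤ C * (n * m) :=
    h n (le_of_max_le_left hn) (n * m) (dualUnipotentRepr_mul_of_pencil hn1 N M hN hM hper)
  have h' : n * n ≤ n * (C * m) := by
    calc n * n = n ^ 2 := (sq n).symm
      _ ≤ C * (n * m) := hsq
      _ = n * (C * m) := by ring
  exact Nat.le_of_mul_le_mul_left h' (by omega)

end Unconstrained

/-! ### §4 The RESOLVENT form: no constraints, no scalars, no determinant

(Appended 2026-08-31, leafhand-val-grenetzeon-2-g3.)  For LINEAR pencils the trace constraints
are automatic consequences of homogeneity, so the cleanest statement of the model is: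
`DualUnipotentRepr n m ↔ ∃ N, M ∈ M_m(linear forms), N^m = 0, per_n = tr((1 − N)⁻¹·M)`
(`dualUnipotentRepr_iff_resolvent`), and the open stub reads: **if `per_n = tr((1 − N)⁻¹·M)` with
`N` a nilpotent and `M` any `m × m` matrix of linear forms, then `m ≥ n²/C`**
(`dualUnipotentBound_iff_resolvent`). -/

section Resolvent

/-- If `N^m = 0` then `tr((1 − N)⁻¹·M) = Σ_{j<m} tr(N^j·M)`. [folklore] -/
theorem trace_inv_one_sub_mul (N M : AffMat n m) (hnil : N ^ m = 0) :
    ((1 - N)⁻¹ * M).trace = ∑ j ∈ Finset.range m, (N ^ j * M).trace := by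
  rw [inv_one_sub_eq_sum_pow N hnil, Finset.sum_mul, Matrix.trace_sum]

/-- **For linear pencils the trace constraints are automatic.**  If `N`, `M` have linear-form
entries and `per_n = Σ_{j<m} tr(N^j·M)`, then `tr(N^j·M) = [j + 1 = n]·per_n` for every `j < m`:
compare homogeneous components (`tr(N^j·M)` is a form of degree `j + 1`, `per_n` one of degree
`n`). [folklore] -/
theorem trace_pow_mul_eq_of_sum_eq (N M : AffMat n m) (hN : ∀ i j, (N i j).IsHomogeneous 1)
    (hM : ∀ i j, (M i j).IsHomogeneous 1)
    (hsum : perPoly (Fin n) ℂ = ∑ j ∈ Finset.range m, (N ^ j * M).trace) {j : ℕ} (hj : j < m) :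
    (N ^ j * M).trace = if j + 1 = n then perPoly (Fin n) ℂ else 0 := by
  have hhom : ∀ i : ℕ, ((N ^ i * M).trace).IsHomogeneous (i + 1) := fun i =>
    isHomogeneous_trace (isHomogeneous_mul_apply (isHomogeneous_pow_apply hN i) hM)
  have hper : (perPoly (Fin n) ℂ).IsHomogeneous n := by
    simpa [Fintype.card_fin] using perPoly_isHomogeneous (n := Fin n) (k := ℂ)
  have h := congrArg (homogeneousComponent (j + 1)) hsum
  rw [map_sum, homogeneousComponent_of_isHomogeneous hper,
    Finset.sum_congr rfl fun i _ => homogeneousComponent_of_isHomogeneous (hhom i) (j + 1)] at h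
  have hcollapse : (∑ i ∈ Finset.range m, if j + 1 = i + 1 then (N ^ i * M).trace else 0)
      = (N ^ j * M).trace := by
    rw [Finset.sum_eq_single_of_mem j (Finset.mem_range.2 hj) fun i _ hij => if_neg (by omega),
      if_pos rfl]
  rw [hcollapse] at h
  exact h.symm

/-- **Resolvent form ⟹ `DualUnipotentRepr` (same width).**  If `N`, `M` are `m × m` matrices of
linear forms with `N^m = 0` and `per_n = tr((1 − N)⁻¹·M)`, then `DualUnipotentRepr n m`: the
constraints hold automatically (`trace_pow_mul_eq_of_sum_eq`) and
`dualUnipotentRepr_of_constrainedPencil` applies. [folklore] -/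
theorem dualUnipotentRepr_of_resolvent (N M : AffMat n m) (hN : ∀ i j, (N i j).IsHomogeneous 1)
    (hM : ∀ i j, (M i j).IsHomogeneous 1) (hnil : N ^ m = 0)
    (hres : perPoly (Fin n) ℂ = ((1 - N)⁻¹ * M).trace) : DualUnipotentRepr n m := by
  rw [trace_inv_one_sub_mul N M hnil] at hres
  have hcon : ∀ j < m, j ≠ n - 1 → (N ^ j * M).trace = 0 := fun j hj hjn => by
    rw [trace_pow_mul_eq_of_sum_eq N M hN hM hres hj, if_neg (by omega)]
  refine dualUnipotentRepr_of_constrainedPencil N M (fun i j => (hN i j).totalDegree_le)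
    (fun i j => (hM i j).totalDegree_le) hnil ?_ hcon
  rw [hres, sum_trace_pow_mul_eq N M hnil hcon]

/-- **The unipotent dual model in RESOLVENT form** (`n ≥ 1`): `DualUnipotentRepr n m` holds iff
`per_n = tr((1 − N)⁻¹·M)` for some `m × m` matrices `N`, `M` of LINEAR FORMS with `N^m = 0`
(no trace constraints, no scalars `α, β, c`, no determinant: all are implied). [folklore] -/
theorem dualUnipotentRepr_iff_resolvent (hn : 1 ≤ n) :
    DualUnipotentRepr n m ↔
      ∃ N M : AffMat n m, (∀ i j, (N i j).IsHomogeneous 1) ∧ (∀ i j, (M i j).IsHomogeneous 1) ∧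
        N ^ m = 0 ∧ perPoly (Fin n) ℂ = ((1 - N)⁻¹ * M).trace := by
  constructor
  · intro h
    obtain ⟨N, M, hN, hM, hnil, hper, hcon⟩ := exists_constrained_pencil_of_dualUnipotentRepr hn h
    refine ⟨N, M, hN, hM, hnil, ?_⟩
    rw [trace_inv_one_sub_mul N M hnil, sum_trace_pow_mul_eq N M hnil fun j _ hj => hcon j hj,
      hper]
  · rintro ⟨N, M, hN, hM, hnil, hres⟩
    exact dualUnipotentRepr_of_resolvent N M hN hM hnil hres

/-- **The stub in resolvent currency.**  `DualUnipotentBound` is EQUIVALENT to: there are `C`,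
`n₀` such that for `n ≥ n₀`, whenever `per_n = tr((1 − N)⁻¹·M)` with `N`, `M` `m × m` matrices of
linear forms and `N^m = 0`, one has `n² ≤ C·m`. [folklore] -/
theorem dualUnipotentBound_iff_resolvent :
    DualUnipotentBound ↔
      ∃ C n₀ : ℕ, ∀ n ≥ n₀, ∀ m : ℕ,
        (∃ N M : AffMat n m, (∀ i j, (N i j).IsHomogeneous 1) ∧ (∀ i j, (M i j).IsHomogeneous 1) ∧
          N ^ m = 0 ∧ perPoly (Fin n) ℂ = ((1 - N)⁻¹ * M).trace) → n ^ 2 ≤ C * m := by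
  constructor
  · rintro ⟨C, n₀, h⟩
    refine ⟨C, max n₀ 1, fun n hn m hP => h n (le_of_max_le_left hn) m ?_⟩
    exact (dualUnipotentRepr_iff_resolvent (le_of_max_le_right hn)).2 hP
  · rintro ⟨C, n₀, h⟩
    refine ⟨C, max n₀ 1, fun n hn m hrep => h n (le_of_max_le_left hn) m ?_⟩
    exact (dualUnipotentRepr_iff_resolvent (le_of_max_le_right hn)).1 hrep

end Resolvent

end Summit.ValiantsHypothesis.ValiantsHypothesis.Cruxes.TwoDimCoefficients.DimTwoCases

end
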